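import Summits.BirchSwinnertonDyer.BirchSwinnertonDyer.Theorems.SignedLowerHalvesSmallImageLowerHalfBothSignsRttD2SeqJ3LayerPairing
import Literature.NumberTheory.EllipticCurves.SubgroupSelmerCocycleCriteriaProofs
import HarnessLib

/-!
# Route `SignedLowerHalves`, crux L `SmallImageLowerHalfBothSigns` (stmt-BirchSwinnertonDyer-23599), line `rtt_w3` v14 → v15 — E2, row J3
# (Galois side, part β₂): THE FINITE-LEVEL LOCAL CARRIERS `H¹(U, M[p^k])` — their maps to `H¹(U, M)`, restriction, inclusion of coefficients, conjugation,
# scalars, EXHAUSTION (`H¹(U, M) = ⋃_k im H¹(U, M[p^k])`, `U` compact, `M` `p`-primary) and KERNEL CONTROL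

WIDTH seat `bsd-line-slh-p3-w3` g22 under LEAD `cruxlead-stmt-BirchSwinnertonDyer-23599` g11 (cell `bsd-ssimc`); helper `--supports stmt-BirchSwinnertonDyer-23599`.
DEFINITIONS WITH BODIES + THEOREMS; no named fact, no instance, no `sorry`. HONEST FRAMING: the `L`/`toH1`/`resLE`/`inclLE`/`conjL`/`scalarL`/`exhaust`/`ker_toH1` block
of the finite-level socket `LayerPairing` (part α′, p784142) for the INTENDED local carriers `L_{n,k} = H¹(U_n, M[p^k])`; generic over a topological group `G` (meant: `Γ_{K_v}`)
acting on a discrete `p`-primary `M` with commuting scalars `R` (meant: `𝒪`). The pairings `pairNK` are part β₃. Nothing arithmetic is proved; E2, crux L, crux M and BSD remain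
OPEN and are proved for NO curve.

* §1 `torsionPow M p k = M[p^k]` (`AddSubgroup.torsionBy`, `G`-stable by the tree's `AddSubgroup.torsionBy.instDistribMulAction`), monotone in `k`; the maps
  `torsToH1 U k : H¹(U, M[p^k]) →+ H¹(U, M)`, `torsIncl U h : H¹(U, M[p^k]) →+ H¹(U, M[p^{k′}])`, `torsScalar U k r`, and the squares: `torsToH1 ∘ torsIncl = torsToH1`,
  `torsToH1 ∘ res = res ∘ torsToH1`, `torsToH1 ∘ conj_σ = conj_σ ∘ torsToH1`, `torsToH1 ∘ torsScalar r = scalarH1 r ∘ torsToH1`.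
* §2 ★ `exists_torsToH1_eq` (EXHAUSTION): for `U` compact and `M` `p`-primary every class of `H¹(U, M)` is the image of a class of `H¹(U, M[p^k])` for some `k` (a continuous
  cocycle takes finitely many values). ★ `exists_torsIncl_eq_zero_of_torsToH1_eq_zero` (KERNEL CONTROL): a class dying in `H¹(U, M)` dies in `H¹(U, M[p^{k′}])` for some `k′ ≥ k`
  (it is the coboundary of some `m ∈ M`, and `m ∈ M[p^{k′}]`).
References: [SerreGaloisCohomology1997] I §2.2; [NeukirchSchmidtWingberg2008] I §5, (1.5.1); [Rubin2000] §4.2, App. B.2.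
-/

set_option autoImplicit false
set_option linter.dupNamespace false -- D-0017: single-problem summit, the namespace repeats the problem name by design
noncomputable section

open scoped Classical

namespace Summit.BirchSwinnertonDyer.BirchSwinnertonDyer.Theorems.SmallImageRttD2Seq

open Literature.NumberTheory.EllipticCurves Literature.NumberTheory.GaloisRepresentations

/-! ## §1. The torsion levels `M[p^k]` and the maps on `H¹(U, ·)` -/

section Levels

variable {G : Type} [Group G] [TopologicalSpace G] [IsTopologicalGroup G]
  (M : Type) [AddCommGroup M] [DistribMulAction G M] [TopologicalSpace M] [DiscreteTopology M] (p : ℕ)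

/-- `M[p^k]`, the `p^k`-torsion of the discrete `G`-module `M` (stable under `G` by the tree's generic instance). [cite: Rubin2000, §4.2] -/
abbrev torsionPow (k : ℕ) : AddSubgroup M :=
  AddSubgroup.torsionBy M ((p ^ k : ℕ) : ℤ)

omit [TopologicalSpace M] [DiscreteTopology M] in
variable {M p} in
/-- Membership in `M[p^k]`: `p^k • m = 0`. [folklore] -/
theorem mem_torsionPow_iff (k : ℕ) (m : M) : m ∈ torsionPow M p k ↔ (p ^ k) • m = 0 := by
  rw [torsionPow, AddSubgroup.torsionBy, Submodule.mem_toAddSubgroup, Submodule.mem_torsionBy_iff, natCast_zsmul]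

omit [TopologicalSpace M] [DiscreteTopology M] in
variable {M p} in
/-- `M[p^k] ≤ M[p^{k′}]` for `k ≤ k′`. [folklore] -/
theorem torsionPow_mono {k k' : ℕ} (h : k ≤ k') : torsionPow M p k ≤ torsionPow M p k' := by
  intro m hm
  rw [mem_torsionPow_iff] at hm ⊢
  obtain ⟨d, hd⟩ := Nat.exists_eq_add_of_le h
  rw [hd, pow_add, mul_comm, mul_smul, hm, smul_zero]

variable (U : Subgroup G)

/-- **`H¹(U, M[p^k]) → H¹(U, M)`** (induced by the inclusion `M[p^k] ⊆ M`). [cite: Rubin2000, §4.2] -/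
def torsToH1 (k : ℕ) : subgroupH1 U ↥(torsionPow M p k) →+ subgroupH1 U M :=
  resH1Hom (ContinuousMonoidHom.id U) (torsionPow M p k).subtype fun _ _ ↦ rfl

/-- **`H¹(U, M[p^k]) → H¹(U, M[p^{k′}])`** for `k ≤ k′` (induced by the inclusion of coefficients). [cite: Rubin2000, §4.2] -/
def torsIncl {k k' : ℕ} (h : k ≤ k') : subgroupH1 U ↥(torsionPow M p k) →+ subgroupH1 U ↥(torsionPow M p k') :=
  resH1Hom (ContinuousMonoidHom.id U) (AddSubgroup.inclusion (torsionPow_mono h)) fun _ _ ↦ rfl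

/-- `torsToH1 ∘ torsIncl = torsToH1` (the coefficient inclusions compose). [folklore] -/
theorem torsToH1_torsIncl {k k' : ℕ} (h : k ≤ k') (ℓ : subgroupH1 U ↥(torsionPow M p k)) :
    torsToH1 M p U k' (torsIncl M p U h ℓ) = torsToH1 M p U k ℓ := by
  rw [← AddMonoidHom.comp_apply, torsToH1, torsIncl, resH1Hom_comp]
  exact DFunLike.congr_fun (resH1Hom_congr rfl (by ext; rfl) _ _) ℓ

/-- `torsToH1` commutes with restriction to a smaller subgroup. [cite: NeukirchSchmidtWingberg2008, I §5] -/
theorem torsToH1_resOfLe {U U' : Subgroup G} (hU : U' ≤ U) (k : ℕ) (ℓ : subgroupH1 U ↥(torsionPow M p k)) :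
    torsToH1 M p U' k (resOfLe (↥(torsionPow M p k)) hU ℓ) = resOfLe M hU (torsToH1 M p U k ℓ) := by
  rw [← AddMonoidHom.comp_apply, ← AddMonoidHom.comp_apply, torsToH1, torsToH1, resOfLe, resOfLe, resH1Hom_comp, resH1Hom_comp]
  exact DFunLike.congr_fun (resH1Hom_congr (by ext; rfl) (by ext; rfl) _ _) ℓ

/-- `torsToH1` commutes with conjugation by `σ ∈ G` (`U` normal). [cite: NeukirchSchmidtWingberg2008, I §5] -/
theorem torsToH1_conjH1 [U.Normal] (σ : G) (k : ℕ) (ℓ : subgroupH1 U ↥(torsionPow M p k)) :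
    torsToH1 M p U k (conjH1 U (↥(torsionPow M p k)) σ ℓ) = conjH1 U M σ (torsToH1 M p U k ℓ) := by
  rw [← AddMonoidHom.comp_apply, ← AddMonoidHom.comp_apply, torsToH1, conjH1, conjH1, resH1Hom_comp, resH1Hom_comp]
  exact DFunLike.congr_fun (resH1Hom_congr (by ext; rfl) (by ext; rfl) _ _) ℓ

variable {R : Type*} [Monoid R] [DistribMulAction R M] [SMulCommClass G R M]

/-- **The scalar `r ∈ R` on `H¹(U, M[p^k])`** (functoriality along `m ↦ r • m`, which preserves `M[p^k]` and commutes with `G`). [cite: Rubin2000, §4.2] -/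
def torsScalar (k : ℕ) (r : R) : subgroupH1 U ↥(torsionPow M p k) →+ subgroupH1 U ↥(torsionPow M p k) :=
  resH1Hom (ContinuousMonoidHom.id U) (DistribSMul.toAddMonoidHom (↥(torsionPow M p k)) r) fun x m ↦ Subtype.ext <| by
    change r • ((x : G) • (m : M)) = (x : G) • (r • (m : M))
    exact (smul_comm (x : G) r (m : M)).symm

omit [TopologicalSpace M] [DiscreteTopology M] in
/-- The scalar on `M[p^k]` is the scalar of `M` (the tree's generic torsion action). [folklore] -/
theorem coe_smul_torsionPow (k : ℕ) (r : R) (m : ↥(torsionPow M p k)) : ((r • m : ↥(torsionPow M p k)) : M) = r • (m : M) := rfl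

/-- `torsToH1 ∘ torsScalar r = scalarH1 r ∘ torsToH1`. [cite: NeukirchSchmidtWingberg2008, I §5] -/
theorem torsToH1_torsScalar (k : ℕ) (r : R) (ℓ : subgroupH1 U ↥(torsionPow M p k)) :
    torsToH1 M p U k (torsScalar M p U k r ℓ) = GreenbergSelmer.scalarH1 U M r (torsToH1 M p U k ℓ) := by
  rw [← AddMonoidHom.comp_apply, ← AddMonoidHom.comp_apply, torsToH1, torsScalar, GreenbergSelmer.scalarH1, resH1Hom_comp, resH1Hom_comp]
  exact DFunLike.congr_fun (resH1Hom_congr (by ext; rfl) (by ext; rfl) _ _) ℓ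

end Levels

/-! ## §2. Exhaustion and kernel control -/

section Exhaustion

variable {G : Type} [Group G] [TopologicalSpace G] [IsTopologicalGroup G]
  {M : Type} [AddCommGroup M] [DistribMulAction G M] [TopologicalSpace M] [DiscreteTopology M] {p : ℕ}
  (U : Subgroup G)

/-- `torsToH1` on an explicit cocycle: the class of the cocycle with the same values. [cite: SerreGaloisCohomology1997, I §2.2] -/
theorem torsToH1_oneCocycleClass (k : ℕ) (ψ : contOneCocycles (discreteTopRep U ↥(torsionPow M p k))) :
    torsToH1 M p U k (oneCocycleClass _ ψ) =
      oneCocycleClass (discreteTopRep U M)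
        (contOneCocycles.pullback (ContinuousMonoidHom.id U) (resHomOfEquivariant (ContinuousMonoidHom.id U) (torsionPow M p k).subtype fun _ _ ↦ rfl) ψ) := by
  change ContinuousCohomology.map _ _ 1 _ = _
  rw [map_oneCocycleClass]

/-- ★ **EXHAUSTION: `H¹(U, M) = ⋃_k im (H¹(U, M[p^k]) → H¹(U, M))`** for `U` compact and `M` `p`-primary — a continuous cocycle on a compact group takes finitely many values in
the discrete `M`, all killed by a common `p^k`. [cite: SerreGaloisCohomology1997, I §2.2] [cite: Rubin2000, App. B.2] -/
theorem exists_torsToH1_eq [CompactSpace U] (hM : ∀ m : M, ∃ k : ℕ, p ^ k • m = 0) (c : subgroupH1 U M) :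
    ∃ (k : ℕ) (ℓ : subgroupH1 U ↥(torsionPow M p k)), torsToH1 M p U k ℓ = c := by
  obtain ⟨φ, rfl⟩ := oneCocycleClass_surjective _ c
  -- a common exponent for the finitely many values of `φ`
  have hfin : (Set.range φ.1).Finite := (isCompact_range φ.1.continuous).finite_of_discrete
  choose e he using hM
  obtain ⟨k, hk⟩ : ∃ k : ℕ, ∀ m ∈ Set.range φ.1, e m ≤ k :=
    ⟨hfin.toFinset.sup e, fun m hm ↦ Finset.le_sup (hfin.mem_toFinset.2 hm)⟩
  have hmem : ∀ u : U, φ.1 u ∈ torsionPow M p k := fun u ↦ by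
    rw [mem_torsionPow_iff]
    obtain ⟨d, hd⟩ := Nat.exists_eq_add_of_le (hk (φ.1 u) ⟨u, rfl⟩)
    rw [hd, pow_add, mul_comm, mul_smul, he, smul_zero]
  -- the cocycle with values in `M[p^k]`
  let ψ : contOneCocycles (discreteTopRep U ↥(torsionPow M p k)) :=
    ⟨⟨fun u ↦ ⟨φ.1 u, hmem u⟩, φ.1.continuous.subtype_mk _⟩, fun u u' ↦ Subtype.ext (φ.2 u u')⟩
  refine ⟨k, oneCocycleClass _ ψ, ?_⟩
  rw [torsToH1_oneCocycleClass]
  congr 1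

/-- ★ **KERNEL CONTROL: a class of `H¹(U, M[p^k])` dying in `H¹(U, M)` dies in `H¹(U, M[p^{k′}])` for some `k′ ≥ k`** (`M` `p`-primary): it is the coboundary of some
`m ∈ M`, and `m` is `p^{e}`-torsion. [cite: SerreGaloisCohomology1997, I §2.2] [cite: Rubin2000, App. B.2] -/
theorem exists_torsIncl_eq_zero_of_torsToH1_eq_zero (hM : ∀ m : M, ∃ k : ℕ, p ^ k • m = 0) (k : ℕ) (ℓ : subgroupH1 U ↥(torsionPow M p k))
    (hℓ : torsToH1 M p U k ℓ = 0) : ∃ (k' : ℕ) (h : k ≤ k'), torsIncl M p U h ℓ = 0 := by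
  obtain ⟨ψ, rfl⟩ := oneCocycleClass_surjective _ ℓ
  obtain ⟨m, hm⟩ := (CocycleCriteria.resH1Hom_oneCocycleClass_eq_zero_iff _ _ _ ψ).1 hℓ
  obtain ⟨e, he⟩ := hM m
  have hme : m ∈ torsionPow M p (k + e) := by
    rw [mem_torsionPow_iff, pow_add, mul_smul, he, smul_zero]
  refine ⟨k + e, Nat.le_add_right k e, (CocycleCriteria.resH1Hom_oneCocycleClass_eq_zero_iff _ _ _ ψ).2 ⟨⟨m, hme⟩, fun x ↦ Subtype.ext ?_⟩⟩
  exact hm x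

end Exhaustion

end Summit.BirchSwinnertonDyer.BirchSwinnertonDyer.Theorems.SmallImageRttD2Seq

end
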